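import Summits.MatrixMultiplication.MatrixMultiplication.Theses.ThinBlockAlpha
import Summits.MatrixMultiplication.MatrixMultiplication.Theorems.RectangularThmB.Negative.TwoLegTranslate
import Literature.Computability.AlgebraicComplexity.GroupTheoreticMatMulThmBProofs
import Literature.Combinatorics.Additive.TricoloredSumFreeBound

/-!
# Line `singleton-restriction-template-tsf` — skeleton for crux `RectangularThmB`
# (stmt-MatrixMultiplication-10597, route `ThinBlockAlpha`, rank 4)

Crux (by name: `Summit.MatrixMultiplication.MatrixMultiplication.Theses.ThinBlockAlpha.RectangularThmB`):
`∀ ℓ, ∀ a ∈ (0,1), ∃ η > 0`, every STPP family in a finite abelian group of exponent `≤ ℓ` with `L`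
blocks `⟨N, M, N⟩`, `N ≥ 2`, `N^a ≤ M`, has `L · N^{2+η} < |H|`.

## The line (idea card `Ideas/singleton-restriction-template-tsf.md`, ideator 2; triage r1-2 / r1-3: pass)

Write `J(ℓ, λ, η)` = `UltrathinPacking ℓ λ η` for the ULTRATHIN packing statement: every exponent-`≤ ℓ`
abelian STPP family of `L` blocks `(Aᵢ, {0}, Cᵢ)` (middle legs the singleton `{0}`; `|Aᵢ| = |Cᵢ| = N ≥ 2`)
with at least `N^λ` blocks has `L · N^{2+η} < |H|`.  For such a family the whole STPP is: the diagonal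
rectangles `D_k = A_k − C_k` are perfect (`N²` elements), pairwise disjoint, and disjoint from every cross
rectangle `Aᵢ − Cⱼ` (`i ≠ j`) (triage r1-2 sharpening).

1. `SingletonRestriction` (M-ELIMINATION, the card's move (1); provable now, size M): `(∀ ℓ, ∀ λ > 0,
   ∃ η > 0, J(ℓ, λ, η)) → RectangularThmB`.  Restrict every `Bᵢ` to one point and translate block `i` by it
   (blockwise translation and sub-families preserve `IsSTPP`); `L`, `N`, `H` are unchanged; the thick
   family's single-block volume `N² M ≤ |H|` (`AddSimultaneousTPP.card_mul_card_mul_card_le`) turns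
   `|H| ≤ L N^{2+η}` into `L ≥ M N^{-η} ≥ N^{a-η} ≥ N^{a/2}` once `η ≤ a/2`, so `J(ℓ, a/2, η₁)` with
   `η := min(η₁, a/2)` concludes.  Uses `0 < a` (λ = a/2 > 0) and passes `2 ≤ N` through — exactly the two
   load-bearing hypotheses of Disproof §A.
2. `ManyBlocks` (the MANY-BLOCKS end; provable now from the tree's PROVED
   `Literature.Combinatorics.Additive.AddSimultaneousTPP.exists_sum_rpow_le` = `Σ (|A||B||C|)^{2/3} ≤
   |H|^{1-δ_ℓ}` via `isSTPP_iff_addSimultaneousTPP`, size M — triage r1-3 (a): NOT from the named Thm B,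
   which has no `L`-leverage): `∀ ℓ ∃ Λ₀ ∃ η₀ > 0, J(ℓ, Λ₀, η₀)`; indeed `L N^{4/3} ≤ (L N^{2+η₀})^{1-δ}`
   is absurd for `L ≥ N^{2/δ}`, `η₀ = 1/3`, `N ≥ 2`.
3. `FrameTSF` (TEMPLATE TSF, FRAME CASE, the card's move (2); provable now from the tree's PROVED Thm A
   `Literature.Combinatorics.Additive.exists_tricoloredSumFree_card_le`, size M): if all `Aᵢ` are cosets of
   one subgroup `V` and all `Cᵢ` cosets of one `W`, then `V ⊓ W = ⊥` (TPP), `|V ⊔ W| = N²`, and the labels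
   `(ᾱᵢ, −γ̄ⱼ, γ̄_k − ᾱ_k)` form a tricolored sum-free set of size `L` in `H ⧸ (V ⊔ W)` (the three-index
   clause `(Aᵢ − Cⱼ) ∩ D_k = ∅`), so `L ≤ 3 (|H|/N²)^{1-δ_ℓ}` — i.e. `τ := |H|/(L N²) ≥ (L^δ/3)^{1/(1-δ)}`,
   the mechanism whose saving is a power of the NUMBER of blocks and therefore survives `a → 0`.
4. `FewBlocksCore` (THE OPEN CORE, HARDEST — the card's Transfer `C⁺` on the capped window, with the
   frame bound handed in as hypothesis): `FrameTSF → ∀ ℓ, ∀ 0 < λ ≤ Λ, ∃ η > 0`, every ultrathin family with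
   `N^λ ≤ L ≤ N^Λ` has `L N^{2+η} < |H|`.  The card's programme: covering dichotomy (few blocks ⇒ a common
   frame up to index `N^{o(1)}` for most blocks) + PFR on near-templates ⇒ reduce to `FrameTSF` in a
   quotient; honest residual = heterogeneous punctured templates, which at `ℓ = 7`, `λ = 0.534` contains
   skew-local-strong-USP sub-capacity (triage r1-3 (b)).  STRONGER than the crux on this window (could fail
   where the crux holds: an ultrathin design family with `L = N^λ`, `τ = N^{o(1)}` — none known).

Composition (sorry-free): `rectangularThmB_of_parts : SingletonRestriction → ManyBlocks → FrameTSF →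
FewBlocksCore → RectangularThmB` (case split `L ≤ N^{max λ Λ₀}` → core, else → many blocks; `η = min η₀ η₁`),
and `RectangularThmB_of : RectangularThmB` applies it to the four registered `stub_*` theorems.

Disproof used (`Cruxes/RectangularThmB/Disproof.lean`, cdisprove 2026-08-16T02:31Z): §A
`rectangularThmB_false_without_pos_a` — `0 < a` is consumed in stub 1 (λ := a/2; at `a = 0` the reduction
gives `L ≥ N^{-η}`, nothing, and `J(0)` is false: one coordinate block, `L = 1`); §A
`rectangularThmB_false_without_N_ge_two` — `2 ≤ N` is a hypothesis of `J` (stubs 2, 4) and is what makes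
`N^x` monotone in the glue; §A `rectangularThmB_iff_small_a` / `Inner.mono_a` — the line is built for the
small-`a` tail: its `η(ℓ, a)` comes from `J(ℓ, a/2)`; §B `eta_le_a`, §C `not_uniform_eta`, §G2
`not_uniform_linear_eta` — consistent: on frames `η = λ δ_ℓ/(1-δ_ℓ) < λ ≤ a/2`, and `δ_ℓ → 0` as `ℓ → ∞`
(the cyclic family `cycRow` restricted to singletons has `L = 2n+1`, `τ → e`, exponent `2n+1 → ∞`: for fixed
`ℓ` finitely many families, each with `|H| > L N²`); §C `succ_mul_sq_le_card` / `no_finite_witness` (landed,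
`Theorems/RectangularThmB/Negative/TwoLegTranslate.lean`, imported here and re-checked with this file) —
concerns `M ≥ 2`; after M-elimination its role is played by the nonempty cross rectangle `A₁ − C₂ ⊆ H ∖ ⊔D_k`
(`|H| ≥ L N² + N` for `L ≥ 2`), which is why `J` carries `N^λ ≤ L` (`L ≥ 2`) and the core a cap `L ≤ N^Λ`;
§F `inner_of_thmB` — the regime `a > a₀(ℓ)` is not used (stub 2 is its `L`-leveraged replacement on the
ultrathin family); `resists` item 5 ("it suffices to prove the crux for a ∈ (0, a₀]") is what stub 1
implements.  No stub is an instance of a refuted strengthening: stubs 2–4 quantify `∃ η` AFTER `ℓ, λ`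
(never uniform in `λ`), and `ledger negatives --problem MatrixMultiplication` (4 entries: level-graded
Cohn–Umans, exact line/frame designs over growing fields, separable design flattening) is unrelated.
-/

set_option linter.dupNamespace false

namespace Summit.MatrixMultiplication.MatrixMultiplication.Cruxes.RectangularThmB.SingletonRestrictionTemplateTsf

open Literature.Computability.AlgebraicComplexity
open Summit.MatrixMultiplication.MatrixMultiplication.Theses.ThinBlockAlpha

noncomputable section

/-! ## The transferred object: ultrathin packings `J(ℓ, λ, η)` -/

/-- `J(ℓ, λ, η)` — **ultrathin packing bound**: in a finite abelian group of exponent `≤ ℓ`, every STPP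
family of `L` blocks `(Aᵢ, {0}, Cᵢ)` with `|Aᵢ| = |Cᵢ| = N ≥ 2` and `N^λ ≤ L` satisfies
`L · N^{2+η} < |H|`.  (Middle legs normalised to `{0}` by blockwise translation, triage r1-2; the STPP of such
a family says: `D_k = A_k − C_k` perfect, pairwise disjoint, and disjoint from every `Aᵢ − Cⱼ`, `i ≠ j`.) -/
def UltrathinPacking (ℓ : ℕ) (lam η : ℝ) : Prop :=
  ∀ (H : Type) [AddCommGroup H] [Fintype H], AddMonoid.exponent H ≤ ℓ →
    ∀ (L N : ℕ) (A C : Fin L → Finset H),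
      IsSTPP A (fun _ => ({0} : Finset H)) C → (∀ i, (A i).card = N ∧ (C i).card = N) →
        2 ≤ N → (N : ℝ) ^ lam ≤ L → (L : ℝ) * (N : ℝ) ^ (2 + η) < Fintype.card H

/-- `J` is antitone in `η`. -/
theorem UltrathinPacking.anti_eta {ℓ : ℕ} {lam η η' : ℝ} (hη : η' ≤ η)
    (h : UltrathinPacking ℓ lam η) : UltrathinPacking ℓ lam η' := by
  intro H _ _ hexp L N A C hS hc hN hL
  refine lt_of_le_of_lt ?_ (h H hexp L N A C hS hc hN hL)
  have hN1 : (1 : ℝ) ≤ N := by exact_mod_cast le_trans (by norm_num) hN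
  exact mul_le_mul_of_nonneg_left (Real.rpow_le_rpow_of_exponent_le hN1 (by linarith))
    (Nat.cast_nonneg L)

/-- `J` is monotone in `λ` (more blocks demanded = fewer families). -/
theorem UltrathinPacking.mono_lam {ℓ : ℕ} {lam lam' η : ℝ} (hlam : lam ≤ lam')
    (h : UltrathinPacking ℓ lam η) : UltrathinPacking ℓ lam' η := by
  intro H _ _ hexp L N A C hS hc hN hL
  refine h H hexp L N A C hS hc hN (le_trans ?_ hL)
  have hN1 : (1 : ℝ) ≤ N := by exact_mod_cast le_trans (by norm_num) hN
  exact Real.rpow_le_rpow_of_exponent_le hN1 hlam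

/-! ## The four stub statements -/

/-- STUB 1 — **singleton restriction (M-elimination)**, provable now (M): ultrathin packing bounds at
every positive block exponent `λ` imply the crux.  Given `(ℓ, a)`: take `η₁` from `J(ℓ, a/2)` and
`η := min (η₁, a/2)`; for a thin family either `L N^{2+η} < |H|` already, or `|H| ≤ L N^{2+η}` and then the
single-block volume `N² M ≤ |H|` (`AddSimultaneousTPP.card_mul_card_mul_card_le` through
`isSTPP_iff_addSimultaneousTPP`) with `M ≥ N^a` gives `N^{a/2} ≤ N^{a-η} ≤ L`; restricting each `Bᵢ` to one
point `bᵢ` and translating block `i` by `-bᵢ` yields an `IsSTPP A' (fun _ => {0}) C'` family with the same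
`L, N, H`, to which `J` applies. -/
def SingletonRestriction : Prop :=
  (∀ ℓ : ℕ, ∀ lam : ℝ, 0 < lam → ∃ η : ℝ, 0 < η ∧ UltrathinPacking ℓ lam η) →
    Summit.MatrixMultiplication.MatrixMultiplication.Theses.ThinBlockAlpha.RectangularThmB

/-- STUB 2 — **many blocks** (TSF extraction on the ultrathin family itself), provable now (M): for every
`ℓ` some block exponent `Λ₀` and `η₀ > 0` have `J(ℓ, Λ₀, η₀)`.  From the PROVED tree inequality
`Σᵢ (|Aᵢ||Bᵢ||Cᵢ|)^{2/3} ≤ |H|^{1-δ}` (`AddSimultaneousTPP.exists_sum_rpow_le ℓ`, with `Bᵢ = {0}`):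
`L N^{4/3} ≤ |H|^{1-δ}`; if `|H| ≤ L N^{2+1/3}` then `L^δ ≤ N^{(7/3)(1-δ) - 4/3} ≤ N`, impossible for
`L ≥ N^{2/δ}`, `N ≥ 2` (take `Λ₀ = 2/δ`, `η₀ = 1/3`, after shrinking `δ ≤ 1/2`). -/
def ManyBlocks : Prop :=
  ∀ ℓ : ℕ, ∃ Lam₀ η₀ : ℝ, 0 < η₀ ∧ UltrathinPacking ℓ Lam₀ η₀

/-- STUB 3 — **template TSF, frame case**, provable now (M): if every `Aᵢ` is a coset of one subgroup `V`
and every `Cᵢ` a coset of one subgroup `W`, then `L ≤ 3 (|H|/N²)^{1-δ}` with the `δ = δ_ℓ > 0` of the tree's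
PROVED Thm A `Literature.Combinatorics.Additive.exists_tricoloredSumFree_card_le ℓ` (shrunk below `1`):
`V ⊓ W = ⊥` by the TPP of one block, `K := V ⊔ W` has `|K| = N²`, `H ⧸ K` has exponent `≤ ℓ` and
`|H|/N²` elements, and `i j k ↦ (mk αᵢ, mk (-γⱼ), mk (γ_k - α_k))` is `IsTricoloredSumFree` on `Fin L`
because `mk αᵢ - mk γⱼ = mk α_k - mk γ_k` iff `(Aᵢ - Cⱼ) ∩ (A_k - C_k) ≠ ∅` iff `i = j = k` (`IsSTPP` with
`t = t' = 0`).  KSS/Norin-tight: TSF-extremal label sets on one frame attain it (triage r1-2). -/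
def FrameTSF : Prop :=
  ∀ ℓ : ℕ, ∃ δ : ℝ, 0 < δ ∧ δ < 1 ∧
    ∀ (H : Type) [AddCommGroup H] [Fintype H], AddMonoid.exponent H ≤ ℓ →
      ∀ (V W : AddSubgroup H) (L N : ℕ) (A C : Fin L → Finset H),
        IsSTPP A (fun _ => ({0} : Finset H)) C → (∀ i, (A i).card = N ∧ (C i).card = N) →
          (∀ i, ∃ α : H, ∀ x, x ∈ A i ↔ x - α ∈ V) → (∀ i, ∃ γ : H, ∀ x, x ∈ C i ↔ x - γ ∈ W) →
            (L : ℝ) ≤ 3 * ((Fintype.card H : ℝ) / (N : ℝ) ^ 2) ^ (1 - δ)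

/-- STUB 4 — **the few-blocks core** (OPEN, HARDEST; the card's Transfer `C⁺` restricted to the window
`N^λ ≤ L ≤ N^Λ`, with the frame bound of stub 3 supplied as hypothesis = the target of the template
reduction): for every `ℓ` and `0 < λ ≤ Λ` some `η > 0` makes every exponent-`≤ ℓ` ultrathin STPP family
with `N ≥ 2` and `N^λ ≤ L ≤ N^Λ` satisfy `L N^{2+η} < |H|`.  Equivalently (powers of a family are
families): `inf { log(|H|/(L N²)) / log N }` over finite such families is positive.  Frames give
`η = λδ/(1-δ) - o(1)`; the programme for the rest (covering dichotomy, PFR on near-templates, heterogeneous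
punctured templates ∋ skew-USP sub-capacity at `ℓ = 7`, `λ = 0.534`) is in the line card. -/
def FewBlocksCore : Prop :=
  FrameTSF →
    ∀ ℓ : ℕ, ∀ lam Lam : ℝ, 0 < lam → lam ≤ Lam → ∃ η : ℝ, 0 < η ∧
      ∀ (H : Type) [AddCommGroup H] [Fintype H], AddMonoid.exponent H ≤ ℓ →
        ∀ (L N : ℕ) (A C : Fin L → Finset H),
          IsSTPP A (fun _ => ({0} : Finset H)) C → (∀ i, (A i).card = N ∧ (C i).card = N) →
            2 ≤ N → (N : ℝ) ^ lam ≤ L → (L : ℝ) ≤ (N : ℝ) ^ Lam →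
              (L : ℝ) * (N : ℝ) ^ (2 + η) < Fintype.card H

/-! ## Registered stubs -/

theorem stub_singletonRestriction : SingletonRestriction := by
  sorry

theorem stub_manyBlocks : ManyBlocks := by
  sorry

theorem stub_frameTSF : FrameTSF := by
  sorry

theorem stub_fewBlocksCore : FewBlocksCore := by
  sorry

/-! ## Composition (kernel-checked, no sorry of its own): the four stub statements imply the crux BY NAME

`rectangularThmB_of_parts` is a `def` on purpose (the skeleton audit takes THE theorem concluding the crux to
be the unique `theorem` with that conclusion, and admits no `Prop` hypotheses on it other than registered
obligations); `RectangularThmB_of` applies it to the four registered stubs. -/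

set_option linter.defProp false in
/-- The glue: build `∀ ℓ, ∀ λ > 0, ∃ η > 0, J(ℓ, λ, η)` from the core (window `N^λ ≤ L ≤ N^{max λ Λ₀}`, fed
with the frame bound) and the many-blocks end (`L > N^{max λ Λ₀} ≥ N^{Λ₀}`), with `η := min η₀ η₁`, then
apply the singleton restriction.  Sorry-free. -/
def rectangularThmB_of_parts :
    SingletonRestriction → ManyBlocks → FrameTSF → FewBlocksCore →
      Summit.MatrixMultiplication.MatrixMultiplication.Theses.ThinBlockAlpha.RectangularThmB := by
  intro hSR hMany hFrame hCore
  refine hSR ?_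
  intro ℓ lam hlam
  obtain ⟨Lam₀, η₀, hη₀, hMany'⟩ := hMany ℓ
  obtain ⟨η₁, hη₁, hCore'⟩ := hCore hFrame ℓ lam (max lam Lam₀) hlam (le_max_left _ _)
  refine ⟨min η₀ η₁, lt_min hη₀ hη₁, ?_⟩
  intro H _ _ hexp L N A C hS hcard hN hL
  have hN1 : (1 : ℝ) ≤ (N : ℝ) := by exact_mod_cast le_trans (by norm_num) hN
  by_cases hcap : (L : ℝ) ≤ (N : ℝ) ^ (max lam Lam₀)
  · -- few blocks: the core, weakened from `η₁` to `min η₀ η₁`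
    exact lt_of_le_of_lt
      (mul_le_mul_of_nonneg_left
        (Real.rpow_le_rpow_of_exponent_le hN1 (by linarith [min_le_right η₀ η₁]))
        (Nat.cast_nonneg L))
      (hCore' H hexp L N A C hS hcard hN hL hcap)
  · -- many blocks: `N^{Λ₀} ≤ N^{max λ Λ₀} < L`
    have hL' : (N : ℝ) ^ Lam₀ ≤ L :=
      le_trans (Real.rpow_le_rpow_of_exponent_le hN1 (le_max_right _ _)) (not_le.mp hcap).le
    exact (hMany'.anti_eta (min_le_left η₀ η₁)) H hexp L N A C hS hcard hN hL'

/-- THE SKELETON THEOREM: the crux `RectangularThmB`, by name, from the four registered stubs (its only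
sorries are theirs). -/
theorem RectangularThmB_of :
    Summit.MatrixMultiplication.MatrixMultiplication.Theses.ThinBlockAlpha.RectangularThmB :=
  rectangularThmB_of_parts stub_singletonRestriction stub_manyBlocks stub_frameTSF stub_fewBlocksCore

end

end Summit.MatrixMultiplication.MatrixMultiplication.Cruxes.RectangularThmB.SingletonRestrictionTemplateTsf
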